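import Mathlib

/-!
# Tangent algebra for `log det` (helpers of the lead's stub `stub_freeTangentBound_of`, line `Sketch`,
idea `free-tangent-landau-chessboard`, crux `QuarksAsStableAction.WilsonQuarkStability`, item stmt-QuantumFields-9736)

Abstract finite-dimensional linear algebra over `ℂ` (no lattice objects):

* `norm_det_sq_le_exp_trace`: `‖det E‖² ≤ exp(Re Tr(EᴴE) − n)` (AM–GM / `λ ≤ e^{λ−1}` on the eigenvalues
  of the positive semidefinite `EᴴE`, Mathlib's spectral theorem `IsHermitian.det_eq_prod_eigenvalues`,
  `trace_eq_sum_eigenvalues`);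
* `norm_det_sq_le_exp_trace_mul` (**A0, the tangent inequality**): for `det D₀ ≠ 0`,
  `‖det D‖² ≤ exp(Re Tr((D₀ᴴD₀)⁻¹ (DᴴD)) − n) · ‖det D₀‖²` — the tangent plane of the concave `log det` at
  the Gram matrix `D₀ᴴD₀` (`E := D D₀⁻¹`); this is `det(1+K) ≤ e^{Tr K}` for `1 + K ⪰ 0`
  (Simon, *Trace ideals*, Ch. 3);
* `re_trace_gram_inv_mul_gram_sub_card`: the expansion of the tangent functional in `Δ = D − D₁`,
  `Re Tr((D₁ᴴD₁)⁻¹ DᴴD) − n = 2 Re Tr(D₁⁻¹Δ) + Re Tr((D₁ᴴD₁)⁻¹ ΔᴴΔ)`;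
* `norm_trace_mul_conjTranspose_mul_self_le`: `‖Tr(A ΔᴴΔ)‖ ≤ (sup ‖A_pq‖) · Σ_r (Σ_q ‖Δ_rq‖)²`.

Pure theorem file (no definitions); Mathlib only.
-/

namespace Summit.QuantumFields.QCD.Cruxes.WilsonQuarkStability.FreeTangentLandauChessboard

open Matrix Complex
open scoped ComplexOrder ComplexConjugate BigOperators

variable {n : Type*} [Fintype n] [DecidableEq n]

/-- `det(EᴴE) ≤ exp(Re Tr(EᴴE) − n)` for every square complex matrix `E` (AM–GM / `λ ≤ e^{λ-1}` on the
eigenvalues of the positive semidefinite matrix `EᴴE`). -/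
theorem norm_det_sq_le_exp_trace (E : Matrix n n ℂ) :
    ‖E.det‖ ^ 2 ≤ Real.exp ((Eᴴ * E).trace.re - Fintype.card n) := by
  have hPSD : (Eᴴ * E).PosSemidef := posSemidef_conjTranspose_mul_self E
  have hH : (Eᴴ * E).IsHermitian := hPSD.isHermitian
  -- `‖det E‖² = det (EᴴE)` as a real number
  have hdet : ((‖E.det‖ ^ 2 : ℝ) : ℂ) = (Eᴴ * E).det := by
    rw [det_mul, det_conjTranspose, Complex.star_def, ← Complex.normSq_eq_norm_sq,
      Complex.normSq_eq_conj_mul_self]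
  have hdetR : ‖E.det‖ ^ 2 = ∏ i, hH.eigenvalues i := by
    have h1 : ((‖E.det‖ ^ 2 : ℝ) : ℂ) = ((∏ i, hH.eigenvalues i : ℝ) : ℂ) := by
      rw [hdet, hH.det_eq_prod_eigenvalues]
      push_cast
      rfl
    exact_mod_cast h1
  have htrR : (Eᴴ * E).trace.re = ∑ i, hH.eigenvalues i := by
    rw [hH.trace_eq_sum_eigenvalues]
    rw [Complex.re_sum]
    simp
  rw [hdetR, htrR]
  have hnn : ∀ i, 0 ≤ hH.eigenvalues i := fun i => hPSD.eigenvalues_nonneg i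
  calc ∏ i, hH.eigenvalues i ≤ ∏ i, Real.exp (hH.eigenvalues i - 1) := by
        apply Finset.prod_le_prod (fun i _ => hnn i)
        intro i _
        have := Real.add_one_le_exp (hH.eigenvalues i - 1)
        linarith
    _ = Real.exp (∑ i, hH.eigenvalues i - Fintype.card n) := by
        rw [← Real.exp_sum, Finset.sum_sub_distrib]
        simp

/-- **A0, the tangent inequality of the line**: for `det D₀ ≠ 0`,
`‖det D‖² ≤ exp(Re Tr((D₀ᴴD₀)⁻¹ (DᴴD)) − n) · ‖det D₀‖²` — the tangent plane of the concave `log det` at the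
Gram matrix `D₀ᴴD₀`. -/
theorem norm_det_sq_le_exp_trace_mul (D D₀ : Matrix n n ℂ) (hD₀ : D₀.det ≠ 0) :
    ‖D.det‖ ^ 2 ≤
      Real.exp ((((D₀ᴴ * D₀)⁻¹ * (Dᴴ * D)).trace.re) - Fintype.card n) * ‖D₀.det‖ ^ 2 := by
  have hU : IsUnit D₀.det := isUnit_iff_ne_zero.mpr hD₀
  set E : Matrix n n ℂ := D * D₀⁻¹ with hE
  have hDE : D = E * D₀ := by
    rw [hE, Matrix.mul_assoc, nonsing_inv_mul _ hU, Matrix.mul_one]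
  -- the trace identity
  have hUH : IsUnit D₀ᴴ.det := by
    rw [det_conjTranspose]; exact hU.star
  have htr : ((D₀ᴴ * D₀)⁻¹ * (Dᴴ * D)).trace = (Eᴴ * E).trace := by
    rw [hDE, conjTranspose_mul, Matrix.mul_inv_rev]
    -- (D₀⁻¹ * D₀ᴴ⁻¹) * ((D₀ᴴ * Eᴴ) * (E * D₀))
    have : D₀⁻¹ * D₀ᴴ⁻¹ * (D₀ᴴ * Eᴴ * (E * D₀)) = D₀⁻¹ * (Eᴴ * E) * D₀ := by
      calc D₀⁻¹ * D₀ᴴ⁻¹ * (D₀ᴴ * Eᴴ * (E * D₀))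
          = D₀⁻¹ * ((D₀ᴴ⁻¹ * D₀ᴴ) * Eᴴ * (E * D₀)) := by
            simp only [Matrix.mul_assoc]
        _ = D₀⁻¹ * (Eᴴ * E) * D₀ := by
            rw [nonsing_inv_mul _ hUH, Matrix.one_mul]
            simp only [Matrix.mul_assoc]
    rw [this, trace_mul_cycle, mul_nonsing_inv _ hU, Matrix.one_mul]
  rw [htr]
  have hdet : ‖D.det‖ ^ 2 = ‖E.det‖ ^ 2 * ‖D₀.det‖ ^ 2 := by
    rw [hDE, det_mul, norm_mul, mul_pow]
  rw [hdet]
  exact mul_le_mul_of_nonneg_right (norm_det_sq_le_exp_trace E) (by positivity)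

/-- **The trace expansion of the tangent functional.**  For `det D₁ ≠ 0` and any `D`, with `Δ = D − D₁`:
`Re Tr((D₁ᴴD₁)⁻¹(DᴴD)) − n = 2 Re Tr(D₁⁻¹ Δ) + Re Tr((D₁ᴴD₁)⁻¹ Δᴴ Δ)`. -/
theorem re_trace_gram_inv_mul_gram_sub_card (D D₁ : Matrix n n ℂ) (hD₁ : D₁.det ≠ 0) :
    (((D₁ᴴ * D₁)⁻¹ * (Dᴴ * D)).trace.re) - Fintype.card n =
      2 * (D₁⁻¹ * (D - D₁)).trace.re + ((D₁ᴴ * D₁)⁻¹ * ((D - D₁)ᴴ * (D - D₁))).trace.re := by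
  have hU : IsUnit D₁.det := isUnit_iff_ne_zero.mpr hD₁
  have hUH : IsUnit D₁ᴴ.det := by rw [det_conjTranspose]; exact hU.star
  set Δ : Matrix n n ℂ := D - D₁ with hΔ
  have hD : D = D₁ + Δ := by rw [hΔ]; abel
  -- `(D₁ᴴD₁)⁻¹ = D₁⁻¹ D₁ᴴ⁻¹`
  have hinv : (D₁ᴴ * D₁)⁻¹ = D₁⁻¹ * D₁ᴴ⁻¹ := Matrix.mul_inv_rev _ _
  -- expand `DᴴD`
  have hexp : Dᴴ * D = D₁ᴴ * D₁ + (D₁ᴴ * Δ + Δᴴ * D₁ + Δᴴ * Δ) := by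
    rw [hD, conjTranspose_add, Matrix.add_mul, Matrix.mul_add, Matrix.mul_add]
    abel
  have h1 : (D₁ᴴ * D₁)⁻¹ * (D₁ᴴ * D₁) = 1 := by
    rw [nonsing_inv_mul]
    rw [det_mul]
    exact hUH.mul hU
  have h2 : (D₁ᴴ * D₁)⁻¹ * (D₁ᴴ * Δ) = D₁⁻¹ * Δ := by
    rw [hinv, Matrix.mul_assoc, ← Matrix.mul_assoc D₁ᴴ⁻¹, nonsing_inv_mul _ hUH, Matrix.one_mul]
  have h3 : ((D₁ᴴ * D₁)⁻¹ * (Δᴴ * D₁)).trace = conj ((D₁⁻¹ * Δ).trace) := by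
    rw [hinv, trace_mul_cycle, Matrix.mul_assoc Δᴴ D₁ D₁⁻¹, mul_nonsing_inv _ hU, Matrix.mul_one]
    -- `Tr(Δᴴ D₁ᴴ⁻¹) = conj Tr(D₁⁻¹ Δ)`
    have : Δᴴ * D₁ᴴ⁻¹ = (D₁⁻¹ * Δ)ᴴ := by
      rw [conjTranspose_mul, conjTranspose_nonsing_inv]
    rw [this, trace_conjTranspose, Complex.star_def]
  have htr : ((D₁ᴴ * D₁)⁻¹ * (Dᴴ * D)).trace =
      Fintype.card n + ((D₁⁻¹ * Δ).trace + conj ((D₁⁻¹ * Δ).trace) +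
        ((D₁ᴴ * D₁)⁻¹ * (Δᴴ * Δ)).trace) := by
    rw [hexp, Matrix.mul_add, Matrix.mul_add, Matrix.mul_add, h1, h2, trace_add, trace_add, trace_add,
      trace_one, h3]
  rw [htr]
  simp only [Complex.add_re, Complex.natCast_re, Complex.conj_re]
  ring

omit [DecidableEq n] in
/-- **Entrywise bound for `Tr(A ΔᴴΔ)`**: if every entry of `A` has norm `≤ γ`, then
`‖Tr(A · ΔᴴΔ)‖ ≤ γ · Σ_r (Σ_q ‖Δ r q‖)²`. -/
theorem norm_trace_mul_conjTranspose_mul_self_le {A Δ : Matrix n n ℂ} {γ : ℝ}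
    (hA : ∀ p q, ‖A p q‖ ≤ γ) :
    ‖(A * (Δᴴ * Δ)).trace‖ ≤ γ * ∑ r, (∑ q, ‖Δ r q‖) ^ 2 := by
  -- expand the trace
  have hexp : (A * (Δᴴ * Δ)).trace = ∑ p, ∑ q, ∑ r, A p q * (conj (Δ r q) * Δ r p) := by
    simp only [trace, diag, mul_apply, conjTranspose_apply, Complex.star_def, Finset.mul_sum]
  have hsq : ∀ r, (∑ q, ‖Δ r q‖) ^ 2 = ∑ p, ∑ q, ‖Δ r q‖ * ‖Δ r p‖ := fun r => by
    rw [sq, Finset.sum_mul_sum, Finset.sum_comm]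
  rw [hexp]
  calc ‖∑ p, ∑ q, ∑ r, A p q * (conj (Δ r q) * Δ r p)‖
      ≤ ∑ p, ∑ q, ∑ r, ‖A p q * (conj (Δ r q) * Δ r p)‖ := by
        refine (norm_sum_le _ _).trans (Finset.sum_le_sum fun p _ => ?_)
        refine (norm_sum_le _ _).trans (Finset.sum_le_sum fun q _ => ?_)
        exact norm_sum_le _ _
    _ ≤ ∑ p, ∑ q, ∑ r, γ * (‖Δ r q‖ * ‖Δ r p‖) := by
        refine Finset.sum_le_sum fun p _ => Finset.sum_le_sum fun q _ => Finset.sum_le_sum fun r _ => ?_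
        rw [norm_mul, norm_mul, Complex.norm_conj]
        exact mul_le_mul_of_nonneg_right (hA p q) (by positivity)
    _ = γ * ∑ r, (∑ q, ‖Δ r q‖) ^ 2 := by
        simp_rw [hsq, Finset.mul_sum]
        -- both sides are triple sums; reorder the right-hand side
        symm
        rw [Finset.sum_comm]
        refine Finset.sum_congr rfl fun p _ => ?_
        rw [Finset.sum_comm]

end Summit.QuantumFields.QCD.Cruxes.WilsonQuarkStability.FreeTangentLandauChessboard
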